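import Summits.BirchSwinnertonDyer.Rank1Residual.Supersingular.RankZeroUpperBoundProp48
import Summits.BirchSwinnertonDyer.Rank1Residual.Supersingular.X8KimTamagawaDefectOPEN
import Summits.BirchSwinnertonDyer.Rank1Residual.Supersingular.X8KimLevelKRankOneOPEN
import Summits.BirchSwinnertonDyer.Rank1Residual.Supersingular.KuriharaTwistRecordGenericLValues
import HarnessLib

/-!
# Good supersingular `p` (any odd `p`, in particular `p = 3`): the `p`-ADIC TOWER `ρ̄_{E,p^n}` onto for
# all `n` from the census bit `surj(p)` ALONE — and the `p = 3` Kurihara-number consumers of classes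
# X8 / X7@3 re-issued WITHOUT any tower certificate, down to a landed `CertifiedOddL` twist record and
# an enclosure of its twisted `L`-values (cell `b2b-bsdres`, supersingular family prover B = unit
# `b2b-bsdres-additive-p3`, gen 21; X8 prover B, X7 joint B, class lead N6·O3; TOOL + compositions)

HONEST FRAMING (run/shared/lean/b2b/bsd-rank1-residual/, verbatim in every file): the goal of the
cell is to DELETE the COMBINATION-SHAPED residual classes of the Birch–Swinnerton-Dyer formula for
ALL analytic-rank `≤ 1` elliptic curves over `ℚ` — "full BSD formula for every rank `≤ 1` curve in
class `C`" assembled STRICTLY from published theorems — so that the rank-`≤ 1` remainder becomes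
exactly the CONSTRUCTION-SHAPED classes, which are TYPED (missing-input `Prop`s), NOT attempted.
This is not "finishing BSD". X6 / X7 / X8 stay CONSTRUCTION-SHAPED; THEOREMS ONLY (compositions of
tree theorems BY NAME; no definition, no named fact, debt 0); per pair; nothing is booked; no mark
moves. Every §2–§3 theorem carrying `hK25s : Kim2025.thm11_kimShaLength_of_integralPeriod_OPEN` is
CONDITIONAL on the ANNOUNCED preprint C.-H. Kim (app. R. Pollack), arXiv:2505.09121 (OPEN binder).

## What

* §1 **`GoodSS.towerSurj_of_surj`** — at a good supersingular `p ≠ 2`, `ρ̄_{E,p}` onto ⟹ `ρ̄_{E,p^n}`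
  onto for every `n`: x10b gen 11's `imageContainsSL2_of_goodSS_of_surj` (Kato's (12.5.2); at `p = 3`
  this is Wuthrich 2014 Lemma 20 in the GOOD supersingular case, PROVED in the tree as
  `Kato2004.imageContainsSL2_of_goodSupersingular_three_of_surj`; at `p ≥ 5` Serre IV-23) followed by
  lit-kato's `Kato2004.forall_hasSurjectiveModNGaloisRep_of_imageContainsSL2` ((12.5.2) ⟺ the tower).
  Class forms `ClassX8.towerSurj_of_surj` (`p = 3`, `a_3 = ±3`), `ClassX7.towerSurj_of_surj`,
  `ClassX6.towerSurj`. So at the supersingular family's pairs NO tower certificate — neither the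
  Frobenius-mod-9 witness (`towerSurj_of_frobenius_of_eq_three`, p250381), nor (ram@3)
  (`ClassX8.towerSurj_of_surj_of_ram`, p249251), nor semistability + Ribet–Diamond — is ever needed.
* §2 the `p = 3` Kurihara consumers of `X8KimTamagawaDefectOPEN.lean` / `X8KimLevelKRankOneOPEN.lean`
  with the witness binders (`ℓ' ≡ 2,5 (9)`, `a_{ℓ'} ≡ 3,6 (9)`) DROPPED: `…_of_surj` forms for
  X8 ∧ `r_an = 0` (`BSD(E,3)` from one level-`3^k` Kurihara number, `k ≤ ord₃ ∏c_ℓ + 1`; the TAM-DEFECT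
  no-unit theorem), X7@3 ∧ `r_an = 0`, X8 / X7@3 ∧ `r_an = 1` (`BSD(E,3) ⟺ ord₃ #Ш_an = 0` from one
  prime-level number, `k ≤ 2`; the `#Ш_an = 9` shape with `k ≤ 4` + `3 ∣ #Ш`).
* §3 **down to the record**: prover A's class-free `CertifiedOddL.kuriharaNumber_ne_zero_of_LValueBall`
  (x10b gen 12, p305898: a landed `CertifiedOddL` row + its `RoundingCertifiedHasse` row + an
  ENCLOSURE of the displayed twisted-`L`-value combination ⟹ `δ̃_n ≢ 0 (mod 3)`) composed with §2:
  `X8RankZero.bsdp_three_of_kim2025_OPEN_of_certifiedOddL_of_LValueBall`,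
  `X7.bsdp_three_rankZero_of_kim2025_OPEN_of_certifiedOddL_of_LValueBall`,
  `X8RankOne.bsdp_iff_padicValRat_eq_zero_of_kim2025_OPEN_of_certifiedOddL_of_LValueBall` — the X8
  twins of x10b's `X6/X7.bsdp_rank{Zero,One}_of_certifiedL_of_LValueBall` (`p ≥ 5`) that prover A left
  to prover B (HOME INBOX 2026-08-21T21:25Z). What remains OUTSIDE the kernel on such a row, plainly:
  (a) the truncation bounds `|L − series|`, (b) ball arithmetic on the finite displayed expression,
  (c) `Ω⁺_f = c_∞·ω₁` (recorded fields) — exactly as for X6/X7 at `p ≥ 5` — and the OPEN binder `hK25s`.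

References: [Kato2004Asterisque] (12.5.2) p. 222; [Wuthrich2014] Lemma 20 (p. 399), Prop. 21 (p. 400);
[SerreAbelianLadic1968] IV-23; [Kim2022StructureSelmer] §1.4.3, Thm. 1.9, Conj. 1.10; [Kim2025RefinedTNC]
Thm. 1.1 (ANNOUNCED, OPEN binder); [SilvermanAEC2009] X.4.14; [MazurTateTeitelbaum1986Invent] §I.8;
[CremonaAlgorithms1997] §2.8; [Miller2011LMS] Def. 1.1.
-/

noncomputable section

open scoped Classical MatrixGroups ModularForm

open CongruenceSubgroup WeierstrassCurve Literature.NumberTheory.EllipticCurves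
  Literature.NumberTheory.EllipticCurves.ModularForms
  Literature.NumberTheory.EllipticCurves.Rank1Residual
  Literature.NumberTheory.EllipticCurves.Rank1Residual.Typed
  Literature.NumberTheory.EllipticCurves.Wuthrich2014
  Summit.BirchSwinnertonDyer.Rank1Residual.Additive
  Summit.BirchSwinnertonDyer.Rank1Residual.Supersingular.KuriharaTwist

namespace Summit.BirchSwinnertonDyer.Rank1Residual.Supersingular

variable (W : WeierstrassCurve ℚ) [W.IsElliptic] [W.IsGloballyMinimal] (p : ℕ) [hp : Fact p.Prime]

/-! ### §1 The tower from `surj(p)` alone at a good supersingular prime -/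

/-- **Good supersingular `p ≠ 2`: `ρ̄_{E,p}` onto ⟹ `ρ̄_{E,p^n}` onto for every `n`** — NO certificate.
Kato's (12.5.2) from `surj(p)` (`imageContainsSL2_of_goodSS_of_surj`: Wuthrich Lemma 20 in the good
case at `p = 3`, Serre IV-23 at `p ≥ 5`), then (12.5.2) ⟺ the tower.
[cite: Wuthrich2014, Lemma 20 (p. 399)] [cite: SerreAbelianLadic1968, Ch. IV §3.4, Lemma 3 (IV-23)]
[cite: Kato2004Asterisque, (12.5.2) in Thm. 12.5 (4) (p. 222)] -/
theorem GoodSS.towerSurj_of_surj (hp2 : p ≠ 2) (hss : GoodSS W p) (hs : Surj W p) (n : ℕ) :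
    W.HasSurjectiveModNGaloisRep (p ^ n : ℕ) :=
  Kato2004.forall_hasSurjectiveModNGaloisRep_of_imageContainsSL2 W p
    (imageContainsSL2_of_goodSS_of_surj W p hp2 hss hs) n

/-- **X8 ∩ {surj(3)}: the `3`-adic tower, NO certificate** (`p = 3`, `a_3 = ±3`, so `3 ∣ a_3` and
Wuthrich's Lemma 20 applies verbatim). Supersedes, on every X8 row, the witness forms
`towerSurj_of_frobenius_of_eq_three` / `ClassX8.towerSurj_of_surj_of_ram` / `…_of_semistable`.
[cite: Wuthrich2014, Lemma 20 (p. 399)] [cite: Kato2004Asterisque, (12.5.2) in Thm. 12.5 (4) (p. 222)] -/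
theorem ClassX8.towerSurj_of_surj (hX : ClassX8 W p) (hs : Surj W p) (n : ℕ) :
    W.HasSurjectiveModNGaloisRep (p ^ n : ℕ) :=
  Kato2004.forall_hasSurjectiveModNGaloisRep_of_imageContainsSL2 W p
    (ClassX8.imageContainsSL2_of_surj W p hX hs) n

/-- **X7 ∩ {surj(p)}, `p ≠ 2`: the `p`-adic tower, NO certificate.** [cite: Wuthrich2014, Lemma 20 (p. 399)]
[cite: SerreAbelianLadic1968, Ch. IV §3.4, Lemma 3 (IV-23)] [cite: Kato2004Asterisque, (12.5.2) in Thm. 12.5 (4) (p. 222)] -/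
theorem ClassX7.towerSurj_of_surj (hp2 : p ≠ 2) (hX : ClassX7 W p) (hs : Surj W p) (n : ℕ) :
    W.HasSurjectiveModNGaloisRep (p ^ n : ℕ) :=
  GoodSS.towerSurj_of_surj W p hp2 hX.1 hs n

/-- **X6, `p ≠ 2`: the `p`-adic tower** (`surj(p)` is automatic on X6, `ClassX6.surj`).
[cite: Serre1972, §5.4 Prop. 21 i)] [cite: Wuthrich2014, Lemma 20 (p. 399)]
[cite: Kato2004Asterisque, (12.5.2) in Thm. 12.5 (4) (p. 222)] -/
theorem ClassX6.towerSurj (hp2 : p ≠ 2) (hX : ClassX6 W p) (n : ℕ) :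
    W.HasSurjectiveModNGaloisRep (p ^ n : ℕ) :=
  Kato2004.forall_hasSurjectiveModNGaloisRep_of_imageContainsSL2 W p (ClassX6.imageContainsSL2 W p hp2 hX) n

/-! ### §2 The `p = 3` Kurihara consumers with the tower certificate DROPPED -/

/-- **N6 = X8 ∧ `r_an = 0` ∧ surj(3): `BSD(E,3)` from ONE level-`3^k` Kurihara number at a cyclic level,
`k ≤ ord₃ ∏ c_ℓ + 1`** — gen 18's `…_of_frobenius` with the Frobenius-mod-9 witness DROPPED (§1).
CONDITIONAL on `hK25s` (OPEN) + `hW` (PUBLISHED); no Manin / Tamagawa binder. Per pair; NOT a class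
theorem. [claim: Kim2025RefinedTNC, status: under-review] [cite: Kim2025RefinedTNC, Thm. 1.1, §8.1.2 (ANNOUNCED, OPEN binder)]
[cite: Wuthrich2014, Lemma 20 (p. 399) and Prop. 21 (p. 400)] [cite: Miller2011LMS, Def. 1.1] -/
theorem X8RankZero.bsdp_three_of_kim2025_OPEN_of_wuthrich_of_kuriharaNumber_ne_zero_of_surj
    (hK25s : Kim2025.thm11_kimShaLength_of_integralPeriod_OPEN) (hW : sha_dvd_analyticSha)
    (hGZK : rank_eq_analyticRank_of_analyticRank_le_one) (hmod : hasEntireLFunction_rat)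
    (h3per : realPeriodRat_eq_unit_mul_plusPeriod_three)
    (hr : W.analyticRank = 0) (hX : ClassX8 W 3) (hs : Surj W 3)
    {N : ℕ} [NeZero N] (D : ModularParametrizationData W N)
    {n k : ℕ} [NeZero n] (hcyc : IsCyclicKolyvaginLevel W 3 n) (hn : Kato.IsKolyvaginProduct W 3 k n)
    (hk : k ≤ padicValNat 3 W.tamagawaProduct + 1)
    (ψ : (ℓ : ℕ) → (ZMod ℓ)ˣ →* Multiplicative (ZMod (3 ^ k)))
    (hψ : ∀ ℓ ∈ n.primeFactors, Function.Surjective (ψ ℓ))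
    (hne : kuriharaNumber D.f (3 ^ k) n ψ ≠ 0) : BSDp W 3 :=
  GoodThree.bsdp_of_kim2025_OPEN_of_wuthrich_of_kuriharaNumber_ne_zero W hK25s hW hGZK hmod h3per
    hX.2.1.1 hr (ClassX8.towerSurj_of_surj W 3 hX hs) D hcyc hn hk ψ hψ hne

/-- **N6's TAM-DEFECT rows carry NO unit Kurihara number** (X8 ∧ `r_an = 0` ∧ surj(3) ∧ `3 ∣ ∏ c_ℓ`),
witness DROPPED. CONDITIONAL on `hK25s` (OPEN) + `hW` (PUBLISHED). Per pair.
[claim: Kim2025RefinedTNC, status: under-review] [cite: Kim2025RefinedTNC, Thm. 1.1, §8.1.2 (ANNOUNCED, OPEN binder)]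
[cite: Wuthrich2014, Lemma 20 (p. 399) and Prop. 21 (p. 400)] -/
theorem X8RankZero.not_kuriharaUnitAt_of_kim2025_OPEN_of_wuthrich_of_dvd_tamagawaProduct_of_surj
    (hK25s : Kim2025.thm11_kimShaLength_of_integralPeriod_OPEN) (hW : sha_dvd_analyticSha)
    (hGZK : rank_eq_analyticRank_of_analyticRank_le_one) (hmod : hasEntireLFunction_rat)
    (h3per : realPeriodRat_eq_unit_mul_plusPeriod_three)
    (hr : W.analyticRank = 0) (hX : ClassX8 W 3) (hs : Surj W 3)
    {N : ℕ} [NeZero N] (D : ModularParametrizationData W N) (htam : 3 ∣ W.tamagawaProduct) :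
    ¬ X4.KuriharaUnitAt W 3 D.f :=
  GoodThree.not_kuriharaUnitAt_of_kim2025_OPEN_of_wuthrich_of_dvd_tamagawaProduct W hK25s hW hGZK hmod
    h3per hX.2.1.1 hr (ClassX8.towerSurj_of_surj W 3 hX hs) D htam

/-- **N5@3 = X7@3 ∧ `r_an = 0` ∧ surj(3): `BSD(E,3)` from ONE level-`3^k` Kurihara number,
`k ≤ ord₃ ∏ c_ℓ + 1`**, witness DROPPED. CONDITIONAL on `hK25s` (OPEN) + `hW` (PUBLISHED). Per pair; X7
joint pair, B side. [claim: Kim2025RefinedTNC, status: under-review] [cite: Kim2025RefinedTNC, Thm. 1.1 (ANNOUNCED, OPEN binder)]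
[cite: Wuthrich2014, Lemma 20 (p. 399) and Prop. 21 (p. 400)] [cite: Miller2011LMS, Def. 1.1] -/
theorem X7.bsdp_three_of_kim2025_OPEN_of_wuthrich_of_kuriharaNumber_ne_zero_of_surj
    (hK25s : Kim2025.thm11_kimShaLength_of_integralPeriod_OPEN) (hW : sha_dvd_analyticSha)
    (hGZK : rank_eq_analyticRank_of_analyticRank_le_one) (hmod : hasEntireLFunction_rat)
    (h3per : realPeriodRat_eq_unit_mul_plusPeriod_three)
    (hr : W.analyticRank = 0) (hX : ClassX7 W 3) (hs : Surj W 3)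
    {N : ℕ} [NeZero N] (D : ModularParametrizationData W N)
    {n k : ℕ} [NeZero n] (hcyc : IsCyclicKolyvaginLevel W 3 n) (hn : Kato.IsKolyvaginProduct W 3 k n)
    (hk : k ≤ padicValNat 3 W.tamagawaProduct + 1)
    (ψ : (ℓ : ℕ) → (ZMod ℓ)ˣ →* Multiplicative (ZMod (3 ^ k)))
    (hψ : ∀ ℓ ∈ n.primeFactors, Function.Surjective (ψ ℓ))
    (hne : kuriharaNumber D.f (3 ^ k) n ψ ≠ 0) : BSDp W 3 :=
  GoodThree.bsdp_of_kim2025_OPEN_of_wuthrich_of_kuriharaNumber_ne_zero W hK25s hW hGZK hmod h3per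
    hX.1.1 hr (ClassX7.towerSurj_of_surj W 3 (by decide) hX hs) D hcyc hn hk ψ hψ hne

/-- **O3 = X8 ∧ `r_an = 1` ∧ surj(3): `BSD(E,3) ⟺ ord₃ #Ш_an = 0` from ONE Kurihara number of level
`k ≤ 2` at a cyclic Kolyvagin prime**, witness DROPPED. CONDITIONAL on `hK25s` (OPEN); `hCT`, `hGZK`,
`hmod` PUBLISHED; NO Manin / period binder. Per pair. [claim: Kim2025RefinedTNC, status: under-review]
[cite: Kim2025RefinedTNC, Thm. 1.1 (ANNOUNCED, OPEN binder)] [cite: SilvermanAEC2009, Thm. X.4.14]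
[cite: Wuthrich2014, Lemma 20 (p. 399)] [cite: Miller2011LMS, Def. 1.1] -/
theorem X8RankOne.bsdp_iff_padicValRat_eq_zero_of_kim2025_OPEN_of_kuriharaNumber_ne_zero_of_surj
    (hK25s : Kim2025.thm11_kimShaLength_of_integralPeriod_OPEN)
    (hCT : exists_casselsTate_pairing (K := ℚ))
    (hGZK : rank_eq_analyticRank_of_analyticRank_le_one) (hmod : hasEntireLFunction_rat)
    (hr : W.analyticRank = 1) (hX : ClassX8 W 3) (hs : Surj W 3)
    {N : ℕ} [NeZero N] (D : ModularParametrizationData W N)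
    {k : ℕ} (hk : 1 ≤ k) (hk2 : k ≤ 2) (ℓ : ℕ) [Fact ℓ.Prime] (hℓ : Kato.IsKolyvaginPrime W 3 k ℓ)
    (hcyc : Nat.card {P : ((WeierstrassCurve.integralModelInt W).map
        (Int.castRingHom (ZMod ℓ))).toAffine.Point // 3 • P = 0} ≤ 3)
    (ψ : (ℓ'' : ℕ) → (ZMod ℓ'')ˣ →* Multiplicative (ZMod (3 ^ k)))
    (hψ : Function.Surjective (ψ ℓ)) (hδ : kuriharaNumber D.f (3 ^ k) ℓ ψ ≠ 0)
    {q : ℚ} (hq : shaAn W = (q : ℂ)) : BSDp W 3 ↔ padicValRat 3 q = 0 :=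
  RankOne.bsdp_iff_padicValRat_eq_zero_of_kim2025_OPEN_of_casselsTate_of_kuriharaNumber_ne_zero W 3 hK25s
    hCT hGZK hmod le_rfl hr (ClassX8.towerSurj_of_surj W 3 hX hs) D hk hk2 ℓ hℓ hcyc ψ hψ hδ hq

/-- **O3's `#Ш_an = 9·unit` rows: `BSD(E,3)` from ONE Kurihara number of level `k ≤ 4` at a cyclic
Kolyvagin prime PLUS the descent bit `3 ∣ #Ш(E/ℚ)`** (X8 ∧ `r_an = 1` ∧ surj(3), `ord₃ #Ш_an = 2`),
witness DROPPED. CONDITIONAL on `hK25s` (OPEN). Per pair. [claim: Kim2025RefinedTNC, status: under-review]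
[cite: Kim2025RefinedTNC, Thm. 1.1 (ANNOUNCED, OPEN binder)] [cite: SilvermanAEC2009, Thm. X.4.14]
[cite: Wuthrich2014, Lemma 20 (p. 399)] [cite: Miller2011LMS, §1 and Def. 1.1] -/
theorem X8RankOne.bsdp_three_of_kim2025_OPEN_of_kuriharaNumber_ne_zero_of_three_dvd_of_surj
    (hK25s : Kim2025.thm11_kimShaLength_of_integralPeriod_OPEN)
    (hCT : exists_casselsTate_pairing (K := ℚ))
    (hGZK : rank_eq_analyticRank_of_analyticRank_le_one) (hmod : hasEntireLFunction_rat)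
    (hr : W.analyticRank = 1) (hX : ClassX8 W 3) (hs : Surj W 3)
    {N : ℕ} [NeZero N] (D : ModularParametrizationData W N)
    {k : ℕ} (hk : 1 ≤ k) (hk4 : k ≤ 4) (ℓ : ℕ) [Fact ℓ.Prime] (hℓ : Kato.IsKolyvaginPrime W 3 k ℓ)
    (hcyc : Nat.card {P : ((WeierstrassCurve.integralModelInt W).map
        (Int.castRingHom (ZMod ℓ))).toAffine.Point // 3 • P = 0} ≤ 3)
    (ψ : (ℓ'' : ℕ) → (ZMod ℓ'')ˣ →* Multiplicative (ZMod (3 ^ k)))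
    (hψ : Function.Surjective (ψ ℓ)) (hδ : kuriharaNumber D.f (3 ^ k) ℓ ψ ≠ 0)
    (hdvd : 3 ∣ W.shaOrder) {q : ℚ} (hq : shaAn W = (q : ℂ)) (hv : padicValRat 3 q = 2) : BSDp W 3 :=
  RankOne.bsdp_of_kim2025_OPEN_of_casselsTate_of_kuriharaNumber_ne_zero_of_pow_dvd W 3 hK25s hCT hGZK hmod
    le_rfl hr (ClassX8.towerSurj_of_surj W 3 hX hs) D (j := 1) hk (by omega) ℓ hℓ hcyc ψ hψ hδ
    (by simpa using hdvd) hq (by rw [hv]; norm_num)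

/-- **O4@3 = X7@3 ∧ `r_an = 1` ∧ surj(3): `BSD(E,3) ⟺ ord₃ #Ш_an = 0` from ONE Kurihara number of
level `k ≤ 2`**, witness DROPPED. CONDITIONAL on `hK25s` (OPEN); X7 joint pair, B side. Per pair.
[claim: Kim2025RefinedTNC, status: under-review] [cite: Kim2025RefinedTNC, Thm. 1.1 (ANNOUNCED, OPEN binder)]
[cite: SilvermanAEC2009, Thm. X.4.14] [cite: Wuthrich2014, Lemma 20 (p. 399)] [cite: Miller2011LMS, Def. 1.1] -/
theorem X7RankOne.bsdp_iff_padicValRat_eq_zero_of_kim2025_OPEN_of_kuriharaNumber_ne_zero_of_surj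
    (hK25s : Kim2025.thm11_kimShaLength_of_integralPeriod_OPEN)
    (hCT : exists_casselsTate_pairing (K := ℚ))
    (hGZK : rank_eq_analyticRank_of_analyticRank_le_one) (hmod : hasEntireLFunction_rat)
    (hr : W.analyticRank = 1) (hX : ClassX7 W 3) (hs : Surj W 3)
    {N : ℕ} [NeZero N] (D : ModularParametrizationData W N)
    {k : ℕ} (hk : 1 ≤ k) (hk2 : k ≤ 2) (ℓ : ℕ) [Fact ℓ.Prime] (hℓ : Kato.IsKolyvaginPrime W 3 k ℓ)
    (hcyc : Nat.card {P : ((WeierstrassCurve.integralModelInt W).map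
        (Int.castRingHom (ZMod ℓ))).toAffine.Point // 3 • P = 0} ≤ 3)
    (ψ : (ℓ'' : ℕ) → (ZMod ℓ'')ˣ →* Multiplicative (ZMod (3 ^ k)))
    (hψ : Function.Surjective (ψ ℓ)) (hδ : kuriharaNumber D.f (3 ^ k) ℓ ψ ≠ 0)
    {q : ℚ} (hq : shaAn W = (q : ℂ)) : BSDp W 3 ↔ padicValRat 3 q = 0 :=
  RankOne.bsdp_iff_padicValRat_eq_zero_of_kim2025_OPEN_of_casselsTate_of_kuriharaNumber_ne_zero W 3 hK25s
    hCT hGZK hmod le_rfl hr (ClassX7.towerSurj_of_surj W 3 (by decide) hX hs) D hk hk2 ℓ hℓ hcyc ψ hψ hδ hq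

/-! ### §3 Down to a landed `CertifiedOddL` twist record + an enclosure of its twisted `L`-values -/

/-- **N6 = X8 ∧ `r_an = 0` ∧ surj(3), `3 ∤ ∏c_ℓ` or not: `BSD(E,3)` from a LANDED `CertifiedOddL` row
`r` (`r.p = 3`, level `r.n ∈ 𝒩₁` cyclic), its rounding certificate `c` and an ENCLOSURE of the twisted
`L`-value combination** — prover A's `CertifiedOddL.kuriharaNumber_ne_zero_of_LValueBall` (unit level,
`k = 1 ≤ ord₃ ∏c_ℓ + 1`) into §2. CONDITIONAL on `hK25s` (OPEN) + `hW` (PUBLISHED); outside the kernel: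
truncation bounds, ball arithmetic, `Ω⁺_f = c_∞·ω₁`. Per pair; NOT a class theorem; nothing booked.
[claim: Kim2025RefinedTNC, status: under-review] [cite: Kim2025RefinedTNC, Thm. 1.1, §8.1.2 (ANNOUNCED, OPEN binder)]
[cite: Kim2022StructureSelmer, §1.4.3 (PDF p. 7)] [cite: Wuthrich2014, Lemma 20 (p. 399) and Prop. 21 (p. 400)]
[cite: MazurTateTeitelbaum1986Invent, §I.8 (8.6)] [cite: CremonaAlgorithms1997, §2.8 (2.8.8) (PDF p. 26)]
[cite: Miller2011LMS, Def. 1.1] -/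
theorem X8RankZero.bsdp_three_of_kim2025_OPEN_of_certifiedOddL_of_LValueBall
    (hK25s : Kim2025.thm11_kimShaLength_of_integralPeriod_OPEN) (hW : sha_dvd_analyticSha)
    (hGZK : rank_eq_analyticRank_of_analyticRank_le_one) (hmod : hasEntireLFunction_rat)
    (h3per : realPeriodRat_eq_unit_mul_plusPeriod_three)
    (hr : W.analyticRank = 0) (hX : ClassX8 W 3) (hs : Surj W 3)
    {N : ℕ} [NeZero N] (D : ModularParametrizationData W N)
    {rs : List TwistRecord} (hrs : CertifiedOddL rs) {r : TwistRecord} (hr' : r ∈ rs) [Fact r.p.Prime]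
    (hrp : r.p = 3) [NeZero r.n] (hν : r.n.primeFactors.card = r.primes.length)
    (hcyc : IsCyclicKolyvaginLevel W r.p r.n)
    {cs : List RoundingCert} (hcs : RoundingCertifiedHasse cs) {c : RoundingCert} (hc : c ∈ cs)
    (hcp : c.p = r.p) (hcn : c.n = r.n) (hcden : c.den = r.den) (hcbins : c.bins = r.bins)
    (hD' : 0 < c.dstar)
    (ψ : (ℓ : ℕ) → (ZMod ℓ)ˣ →* Multiplicative (ZMod (r.p ^ 1)))
    (hψ : ∀ ℓ ∈ r.n.primeFactors, Function.Surjective (ψ ℓ))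
    (hballL : ∀ (L : ZMod (r.p ^ 1) → ℂ → ℂ), (∀ j, j ≠ 0 → Differentiable ℂ (L j)) →
      (∀ j, j ≠ 0 → ∀ s : ℂ, 2 < s.re → L j s = twistedLSeries D.f (binChar r.n ψ j)⁻¹ s) →
      ∀ k < r.p, ∃ mid rad : ℝ, rad ≤ (c.radNum : ℝ) / 10 ^ c.radExp ∧
        |mid - ((c.binsStar.getD k 0 : ℤ) : ℝ)| ≤ (c.marNum : ℝ) / 10 ^ c.marExp ∧
        |(c.dstar : ℝ) * ((r.components : ℝ) *
          (((∏ ℓ ∈ r.n.primeFactors, ((W.frobeniusTrace ℓ : ℂ) - 2)) * W.entireLFunction 1 +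
            ∑ j ∈ (Finset.univ : Finset (ZMod (r.p ^ 1))).erase 0,
              ZMod.stdAddChar (-(j * (k : ZMod (r.p ^ 1)))) *
                (gaussSum (binChar r.n ψ j) (ZMod.stdAddChar (N := r.n)) * L j 1)).re /
            ((r.p ^ 1 : ℕ) * plusPeriod D.f))) - mid| ≤ rad) :
    BSDp W 3 := by
  obtain ⟨lab, ai, cond, p', n', prs, rts, comp, rk, red, den, bins, dmp, ev⟩ := r
  dsimp only at hrp
  subst hrp
  have hne := CertifiedOddL.kuriharaNumber_ne_zero_of_LValueBall hrs hr' hν D.isNewformOf (by norm_num)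
    (hasIrreducibleModPGaloisRep_of_hasSurjectiveModNGaloisRep W 3 hs) hX.2.1.1 hcyc.1 hcs hc hcp hcn
    hcden hcbins hD' ψ hψ hballL
  exact X8RankZero.bsdp_three_of_kim2025_OPEN_of_wuthrich_of_kuriharaNumber_ne_zero_of_surj W hK25s hW
    hGZK hmod h3per hr hX hs D hcyc hcyc.1 (by omega) ψ hψ hne

/-- **N5@3 = X7@3 ∧ `r_an = 0` ∧ surj(3): `BSD(E,3)` from a LANDED `CertifiedOddL` row (`r.p = 3`, cyclic
level `r.n ∈ 𝒩₁`), its rounding certificate and an enclosure of the twisted `L`-value combination**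
(unit level `k = 1`). CONDITIONAL on `hK25s` (OPEN) + `hW` (PUBLISHED); X7 joint pair, B side. Per pair;
NOT a class theorem; nothing booked. [claim: Kim2025RefinedTNC, status: under-review]
[cite: Kim2025RefinedTNC, Thm. 1.1 (ANNOUNCED, OPEN binder)] [cite: Kim2022StructureSelmer, §1.4.3 (PDF p. 7)]
[cite: Wuthrich2014, Lemma 20 (p. 399) and Prop. 21 (p. 400)] [cite: MazurTateTeitelbaum1986Invent, §I.8 (8.6)]
[cite: CremonaAlgorithms1997, §2.8 (2.8.8) (PDF p. 26)] [cite: Miller2011LMS, Def. 1.1] -/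
theorem X7.bsdp_three_rankZero_of_kim2025_OPEN_of_certifiedOddL_of_LValueBall
    (hK25s : Kim2025.thm11_kimShaLength_of_integralPeriod_OPEN) (hW : sha_dvd_analyticSha)
    (hGZK : rank_eq_analyticRank_of_analyticRank_le_one) (hmod : hasEntireLFunction_rat)
    (h3per : realPeriodRat_eq_unit_mul_plusPeriod_three)
    (hr : W.analyticRank = 0) (hX : ClassX7 W 3) (hs : Surj W 3)
    {N : ℕ} [NeZero N] (D : ModularParametrizationData W N)
    {rs : List TwistRecord} (hrs : CertifiedOddL rs) {r : TwistRecord} (hr' : r ∈ rs) [Fact r.p.Prime]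
    (hrp : r.p = 3) [NeZero r.n] (hν : r.n.primeFactors.card = r.primes.length)
    (hcyc : IsCyclicKolyvaginLevel W r.p r.n)
    {cs : List RoundingCert} (hcs : RoundingCertifiedHasse cs) {c : RoundingCert} (hc : c ∈ cs)
    (hcp : c.p = r.p) (hcn : c.n = r.n) (hcden : c.den = r.den) (hcbins : c.bins = r.bins)
    (hD' : 0 < c.dstar)
    (ψ : (ℓ : ℕ) → (ZMod ℓ)ˣ →* Multiplicative (ZMod (r.p ^ 1)))
    (hψ : ∀ ℓ ∈ r.n.primeFactors, Function.Surjective (ψ ℓ))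
    (hballL : ∀ (L : ZMod (r.p ^ 1) → ℂ → ℂ), (∀ j, j ≠ 0 → Differentiable ℂ (L j)) →
      (∀ j, j ≠ 0 → ∀ s : ℂ, 2 < s.re → L j s = twistedLSeries D.f (binChar r.n ψ j)⁻¹ s) →
      ∀ k < r.p, ∃ mid rad : ℝ, rad ≤ (c.radNum : ℝ) / 10 ^ c.radExp ∧
        |mid - ((c.binsStar.getD k 0 : ℤ) : ℝ)| ≤ (c.marNum : ℝ) / 10 ^ c.marExp ∧
        |(c.dstar : ℝ) * ((r.components : ℝ) *
          (((∏ ℓ ∈ r.n.primeFactors, ((W.frobeniusTrace ℓ : ℂ) - 2)) * W.entireLFunction 1 +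
            ∑ j ∈ (Finset.univ : Finset (ZMod (r.p ^ 1))).erase 0,
              ZMod.stdAddChar (-(j * (k : ZMod (r.p ^ 1)))) *
                (gaussSum (binChar r.n ψ j) (ZMod.stdAddChar (N := r.n)) * L j 1)).re /
            ((r.p ^ 1 : ℕ) * plusPeriod D.f))) - mid| ≤ rad) :
    BSDp W 3 := by
  obtain ⟨lab, ai, cond, p', n', prs, rts, comp, rk, red, den, bins, dmp, ev⟩ := r
  dsimp only at hrp
  subst hrp
  have hne := CertifiedOddL.kuriharaNumber_ne_zero_of_LValueBall hrs hr' hν D.isNewformOf (by norm_num)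
    (hasIrreducibleModPGaloisRep_of_hasSurjectiveModNGaloisRep W 3 hs) hX.1.1 hcyc.1 hcs hc hcp hcn
    hcden hcbins hD' ψ hψ hballL
  exact X7.bsdp_three_of_kim2025_OPEN_of_wuthrich_of_kuriharaNumber_ne_zero_of_surj W hK25s hW hGZK hmod
    h3per hr hX hs D hcyc hcyc.1 (by omega) ψ hψ hne

/-- **O3 = X8 ∧ `r_an = 1` ∧ surj(3): `BSD(E,3) ⟺ ord₃ #Ш_an = 0` from a LANDED prime-level
`CertifiedOddL` row (`r.p = 3`, `r.n = ℓ ∈ 𝒫₁` with cyclic `3`-part), its rounding certificate and an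
enclosure of the twisted `L`-value combination** (unit level). CONDITIONAL on `hK25s` (OPEN); `hCT`,
`hGZK`, `hmod` PUBLISHED; NO Manin / period binder. Per pair; NOT a class theorem; nothing booked.
[claim: Kim2025RefinedTNC, status: under-review] [cite: Kim2025RefinedTNC, Thm. 1.1 (ANNOUNCED, OPEN binder)]
[cite: Kim2022StructureSelmer, §1.4.3 (PDF p. 7)] [cite: SilvermanAEC2009, Thm. X.4.14]
[cite: Wuthrich2014, Lemma 20 (p. 399)] [cite: MazurTateTeitelbaum1986Invent, §I.8 (8.6)]
[cite: CremonaAlgorithms1997, §2.8 (2.8.8) (PDF p. 26)] [cite: Miller2011LMS, Def. 1.1] -/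
theorem X8RankOne.bsdp_iff_padicValRat_eq_zero_of_kim2025_OPEN_of_certifiedOddL_of_LValueBall
    (hK25s : Kim2025.thm11_kimShaLength_of_integralPeriod_OPEN)
    (hCT : exists_casselsTate_pairing (K := ℚ))
    (hGZK : rank_eq_analyticRank_of_analyticRank_le_one) (hmod : hasEntireLFunction_rat)
    (hr : W.analyticRank = 1) (hX : ClassX8 W 3) (hs : Surj W 3)
    {N : ℕ} [NeZero N] (D : ModularParametrizationData W N)
    {rs : List TwistRecord} (hrs : CertifiedOddL rs) {r : TwistRecord} (hr' : r ∈ rs) [Fact r.p.Prime]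
    (hrp : r.p = 3) [hrn : Fact r.n.Prime] (hν : r.n.primeFactors.card = r.primes.length)
    (hℓ : Kato.IsKolyvaginPrime W r.p 1 r.n)
    (hcyc : Nat.card {P : ((WeierstrassCurve.integralModelInt W).map
        (Int.castRingHom (ZMod r.n))).toAffine.Point // r.p • P = 0} ≤ r.p)
    {cs : List RoundingCert} (hcs : RoundingCertifiedHasse cs) {c : RoundingCert} (hc : c ∈ cs)
    (hcp : c.p = r.p) (hcn : c.n = r.n) (hcden : c.den = r.den) (hcbins : c.bins = r.bins)
    (hD' : 0 < c.dstar)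
    (ψ : (ℓ : ℕ) → (ZMod ℓ)ˣ →* Multiplicative (ZMod (r.p ^ 1)))
    (hψ : Function.Surjective (ψ r.n))
    (hballL : ∀ (L : ZMod (r.p ^ 1) → ℂ → ℂ), (∀ j, j ≠ 0 → Differentiable ℂ (L j)) →
      (∀ j, j ≠ 0 → ∀ s : ℂ, 2 < s.re → L j s = twistedLSeries D.f (binChar r.n ψ j)⁻¹ s) →
      ∀ k < r.p, ∃ mid rad : ℝ, rad ≤ (c.radNum : ℝ) / 10 ^ c.radExp ∧
        |mid - ((c.binsStar.getD k 0 : ℤ) : ℝ)| ≤ (c.marNum : ℝ) / 10 ^ c.marExp ∧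
        |(c.dstar : ℝ) * ((r.components : ℝ) *
          (((∏ ℓ ∈ r.n.primeFactors, ((W.frobeniusTrace ℓ : ℂ) - 2)) * W.entireLFunction 1 +
            ∑ j ∈ (Finset.univ : Finset (ZMod (r.p ^ 1))).erase 0,
              ZMod.stdAddChar (-(j * (k : ZMod (r.p ^ 1)))) *
                (gaussSum (binChar r.n ψ j) (ZMod.stdAddChar (N := r.n)) * L j 1)).re /
            ((r.p ^ 1 : ℕ) * plusPeriod D.f))) - mid| ≤ rad)
    {q : ℚ} (hq : shaAn W = (q : ℂ)) : BSDp W 3 ↔ padicValRat 3 q = 0 := by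
  haveI : NeZero r.n := ⟨hrn.out.ne_zero⟩
  have hψ' : ∀ ℓ ∈ r.n.primeFactors, Function.Surjective (ψ ℓ) := fun ℓ hℓ' => by
    rw [hrn.out.primeFactors, Finset.mem_singleton] at hℓ'
    subst hℓ'
    exact hψ
  obtain ⟨lab, ai, cond, p', n', prs, rts, comp, rk, red, den, bins, dmp, ev⟩ := r
  dsimp only at hrp
  subst hrp
  have hne := CertifiedOddL.kuriharaNumber_ne_zero_of_LValueBall hrs hr' hν D.isNewformOf (by norm_num)
    (hasIrreducibleModPGaloisRep_of_hasSurjectiveModNGaloisRep W 3 hs) hX.2.1.1 hℓ.isKolyvaginProduct hcs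
    hc hcp hcn hcden hcbins hD' ψ hψ' hballL
  exact X8RankOne.bsdp_iff_padicValRat_eq_zero_of_kim2025_OPEN_of_kuriharaNumber_ne_zero_of_surj W hK25s
    hCT hGZK hmod hr hX hs D le_rfl (by norm_num) _ hℓ hcyc ψ hψ hne hq

end Summit.BirchSwinnertonDyer.Rank1Residual.Supersingular

end
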